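import Summits.BirchSwinnertonDyer.BirchSwinnertonDyer.Theses.UniversalToricDescent
import Summits.BirchSwinnertonDyer.BirchSwinnertonDyer.Theorems.EisensteinPrimesHidaLimitFittingBoundConverse
import Summits.BirchSwinnertonDyer.Rank1Residual.X2.HidaLimitCongruenceAlgebra
import Literature.NumberTheory.EllipticCurves.IwasawaAlgebraHeightOneCriterionProofs
import HarnessLib

/-!
# NODE (D-0171) on crux stmt-BirchSwinnertonDyer-24207 `UniversalToricDescent.RationalSplitIMCInclusionAtThree`
# — line `nonsplit_patching_saturation` (crux-ideate seat `cruxidea-stmt-BirchSwinnertonDyer-24207-1` gen 3, 2026-08-30)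

KIND: IMPLIED-BY through ONE EQUIVALENT intermediate node.  0 sorry, no new axiom, no named fact consumed; `no_new_routes`.
`closes`-analogues CHECKED below (kernel, BY NAME):
* `rationalSplitIMCInclusionAtThree_of_interiorRootwise : InteriorRootwiseBoundAtThree → UTD.RationalSplitIMCInclusionAtThree`
* `interiorRootwise_of_rationalSplitIMCInclusionAtThree : UTD.RationalSplitIMCInclusionAtThree → InteriorRootwiseBoundAtThree`
  (so node I is ⟺ the crux — an EQUIV node; its CHILD decomposition is the pair C ∧ M:)
* `interiorRootwise_of_cyclic_of_saturation : CyclicAcSelmerAtThree → CyclicModularSaturationAtThree → InteriorRootwiseBoundAtThree`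
* `rationalSplitIMCInclusionAtThree_of_cyclic_of_saturation : CyclicAcSelmerAtThree → CyclicModularSaturationAtThree → crux`.

THE MOVE («classes ⇒ congruences», Kato's direction by MODULARITY LIFTING, read at INTERIOR primes only).
24207 is the RATIONAL wall `∃ k, 3^k·L ∈ Ch_Λ(X_(∅,0))·R₀⟦T⟧`.  By the tree's height-one criterion
(`PowerSeries.exists_C_pow_mul_mem_span_of_forall_heightOne`, file `IwasawaAlgebraHeightOneCriterionProofs`) and the
principality of `Ch_Λ` (`charIdeal_isPrincipal_holds`) it is EQUIVALENT (node I, both directions proved here) to the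
ROOT-WISE statement at the INTERIOR height-one primes `𝔮 ∌ 3` of `R₀⟦T⟧`:  `Ch·R₀⟦T⟧ ⊆ 𝔮ⁿ ⟹ (L) ⊆ 𝔮ⁿ`, i.e.
`length_𝔮 X_(∅,0) ≤ ord_𝔮 L_𝔭^{BDP}` — every `3`-power constant (Tamagawa, torsion, `c_f = #Sel(ad⁰f)`, the local zeta
integral of the supercuspidal new vector at 3, Gorenstein defects at the maximal ideal) is INVISIBLE there.  The idea
supplies that inequality, for CYCLIC `X` (node C, instrumentable), by running Wan's semi-ordinary `U(3,1)` Klingen–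
Eisenstein congruence machine BACKWARDS (node M): instead of «congruences ⇒ classes» (Ribet/Skinner–Urban/Wan lattice,
the EISENSTEIN direction = SOED's crux E / card eisenstein-kato-swap P1), prove «classes ⇒ congruences»: a Λ_𝔮/𝔮ᵃ-valued
(∅,0)-class `c` is an upper-triangular P-ordinary deformation `ρ_c` of the NON-SPLIT, SCHUR (`End = 𝔽₃`) residual
representation `ρ₀ = (ρ̄_E|_K·χ̄₁ ∗ ; 0 χ̄₂)` (`∗` = a generator of the residual (∅,0)-Selmer line — non-zero exactly when
24207 has content); a modularity-lifting theorem `R^{P-ord}_{ρ₀} = 𝕋^{cusp,P-ord}_𝔪` (Λ-adic Taylor–Wiles–Kisin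
patching; TW primes `q ≡ 1 (3ⁿ)` split in K EXIST at p = 3 — they are not the level-raising admissible primes killed by
`NoAdmissiblePrimesAtThree`, and `H¹(SL₂(𝔽₃), W̄) = 0` because `Q₈` has no fixed vector on `W̄`) makes `ρ_c` a CUSPIDAL
eigensystem congruent to the Klingen–Eisenstein system modulo `𝔮ᵃ`, whence `a ≤ e_𝔮 := ord_𝔮(𝕋_𝔪/Eis)`; and the
Fourier–Jacobi CONSTANT TERM of the Λ-adic Klingen family («divisible by 𝓛^Σ_{f,K,ξ}·𝓛^Σ_{χ̄ξ′}»,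
[corpus:paper:arxiv-1408.4044 p.30 Prop. 6.5]; constant terms along parabolics p.17 §4.4) caps the congruence depth,
`e_𝔮 ≤ ord_𝔮 𝓛^Σ + ord_𝔮 𝓛_{χ̄ξ′}`, as soon as eigenvalue congruences at 𝔪 are congruences of FJ expansions
(Gorenstein / multiplicity one of `𝕋_𝔪`); the Dirichlet factor is constant on the anticyclotomic line (a 3-adic
number, interior-invisible) and Σ-imprimitivity is carried on both sides (Greenberg–Vatsal local factors), giving
`length_𝔮 X ≤ ord_𝔮 L` at every interior 𝔮.  No Λ-adic class, Coleman map or `U₃`-eigenvector of `f_E` at the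
trace-zero prime is ever used (`TraceZeroHeegnerTowerAtAdditiveSplitP` does not quantify over this lever).

PIECES AND TAGS (evidence):
* I `InteriorRootwiseBoundAtThree` — **EQUIV** (⟺ crux; both directions kernel-checked below; pure commutative algebra
  over the UFD `R₀⟦T⟧`: `charIdeal_isPrincipal_holds`, `Ideal.map_span`, the height-one criterion, and for the converse
  `Ideal.eq_span_singleton_of_height_eq_one` is NOT needed — `Prime.pow_dvd_of_dvd_mul_left` on a generator).  CHILD = C ∧ M.
* C `CyclicAcSelmerAtThree` — **UNDECIDED · leaf INSTRUMENTABLE/KILLABLE**: `X_(∅,0)(E/K_∞)` is a CYCLIC Λ-module on the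
  torsion locus (⟺ by Nakayama + the PROVED exact control `WildSplitControlAtThree` 24475: the residual (∅,0)-Selmer group
  `Sel_(∅,0)(K, E[3])` has 𝔽₃-dimension ≤ 1).  Instrument Q-CYC-1 (habitat 135a1, K = ℚ(√−11), p = 3): `dim_𝔽₃ Sel₃(E/K)`
  with the relaxed-at-𝔭 / strict-at-𝔭̄ modification — a finite 3-descent; NOT RUN (kit 0).  If C fails for some W of the
  class, M still yields the EXPONENT bound `𝔮^{e_𝔮}·X_𝔮 = 0` (leaf C′ BARRIER-type: patching deforms ONE residual class).
* M `CyclicModularSaturationAtThree` — **WEAKER-conditional** (= node I restricted to cyclic X) · **UNDECIDED**; leaves: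
  M1 IDEA-NEEDED — Λ-adic patching for the non-split Schur residual representation in the semi-ordinary (Klingen-parabolic)
  `U(3,1)` Hida family with FIXED SUPERCUSPIDAL TYPE on the GL₂-Levi at the split prime 3 (print: Thorne JAMS 2015 treats
  ρ̄^{ss} Schur-in-𝒢ₙ, Borel-ordinary, and outputs no Selmer bound [corpus:paper:url-2526149c354b p.1–3]; Berger–Klosin
  prove `R_{ρ₀} = 𝕋` for non-split ρ₀ only WITH `#Sel ≤ #𝒪/L` as INPUT [corpus:paper:arxiv-1103.5100 p.3–4]; Wake–Wang-
  Erickson: pseudo-modularity ⟺ Gorenstein ⟺ a Greenberg-type vanishing [corpus:paper:arxiv-1505.05128 p.2–4]);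
  M2 ATTACKABLE-literature-with-gap — the constant-term CEILING `ord_𝔮(𝕋_𝔪/Eis) ≤ ord_𝔮(𝓛^Σ·𝓛_{χ̄ξ′})` given FJ
  multiplicity one at 𝔪 [corpus:paper:arxiv-1408.4044 p.30 Prop. 6.5]; M3 ATTACKABLE — interior bookkeeping of Σ-factors
  and the (constant) Dirichlet factor.
WHY EASIER.  M asks for ONE inequality per interior prime between two Hecke-side integers and never touches the 3-adic
boundary `𝔮 = (3)` where every killed line of this cell died (U₃-trace zero, no admissible primes, 3^{O(slope)} losses,
order-1 universal norms); the residual representation that is patched is Schur although reducible, so Mazur's functor is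
representable and the TW numerology has defect 0.
WHY NOVEL.  Every route, line and card on 24207/20395/20479 either manufactures classes for `f_E` (BF/toric/Heegner/
Coleman: LEAD, universal-toric-half-order, base-doubling-tau-signs) or runs the Eisenstein congruence machine FORWARD
(SOED, higher-klingen-gu22, wedge-square-host, eisenstein-kato-swap); none runs it BACKWARD — modularity of the
non-split reducible deformation as the source of Kato's inequality — and the only R = T lever in the cell
(numerical-criterion-local-jump, crux CartanOnePlaceDegreeLaw) is a Wiles–Lenstra length identity for an IRREDUCIBLE ρ̄
on a different crux.
HONEST STATUS: M1 is research mathematics beyond print; nothing here proves BSD for any curve.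
-/

set_option autoImplicit false
set_option linter.dupNamespace false

noncomputable section

open scoped Classical

namespace Summit.BirchSwinnertonDyer.BirchSwinnertonDyer.Cruxes.RationalSplitIMCInclusionAtThree.NonsplitPatchingSaturation

open PowerSeries Literature.NumberTheory.EllipticCurves
  Summit.BirchSwinnertonDyer.Rank1Residual.X11b

/-- **I [EQUIV · both directions proved below]** the ROOT-WISE form of 24207 at the INTERIOR height-one primes of
`R₀⟦T⟧`: under 24207's binders, if `X_(∅,0)` is Λ-torsion then for every height-one prime `𝔮 ∌ C 3` and every `n`,
`Ch_Λ(X_(∅,0))·R₀⟦T⟧ ⊆ 𝔮ⁿ ⟹ (L) ⊆ 𝔮ⁿ` (`length_𝔮 X ≤ ord_𝔮 L`). -/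
def InteriorRootwiseBoundAtThree : Prop :=
  ∀ (W : WeierstrassCurve ℚ) [W.IsElliptic] [W.IsGloballyMinimal] (N : ℕ) [NeZero N] (K : Type) [Field K] [NumberField K] (Dt : Literature.NumberTheory.EllipticCurves.ModularForms.ModularParametrizationData W N), Summit.BirchSwinnertonDyer.Rank1Residual.Additive.ClassO6 W 3 → W.HasSurjectiveModNGaloisRep 3 → W.analyticRank = 1 → W.conductorNorm ℤ = N → Literature.NumberTheory.EllipticCurves.IsImaginaryQuadratic K → Literature.NumberTheory.EllipticCurves.SatisfiesHeegnerHypothesis N K → ∀ (κ : Literature.NumberTheory.EllipticCurves.ZpExtension K 3), κ.IsAnticyclotomic → ∀ (γ : Field.absoluteGaloisGroup K) [Fact (κ.IsTopGenerator γ)] (𝔭 : IsDedekindDomain.HeightOneSpectrum (NumberField.RingOfIntegers K)), ((3 : ℕ) : NumberField.RingOfIntegers K) ∈ 𝔭.asIdeal → 𝔭.asIdeal.ramificationIdx (NumberField.RingOfIntegers ℚ) = 1 → 𝔭.asIdeal.inertiaDeg (NumberField.RingOfIntegers ℚ) = 1 → ∀ (𝔭' : IsDedekindDomain.HeightOneSpectrum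 (NumberField.RingOfIntegers K)), ((3 : ℕ) : NumberField.RingOfIntegers K) ∈ 𝔭'.asIdeal → 𝔭' ≠ 𝔭 → ∀ (ι' : PadicAlgCl 3 ≃+* ℂ), Summit.BirchSwinnertonDyer.BirchSwinnertonDyer.Theorems.SchneiderFree.BranchInducesPrime 3 ι' 𝔭 → ∀ (ΩK : ℂ) (Ωp : ℂ_[3]) (L : Literature.NumberTheory.EllipticCurves.UnrSeries 3), ΩK ≠ 0 → Ωp ≠ 0 → Literature.NumberTheory.EllipticCurves.IsBDPLFunction ι' 𝔭 κ γ Dt.f ΩK Ωp L → Module.IsTorsion (Literature.NumberTheory.EllipticCurves.IwasawaAlgebra 3) (Summit.BirchSwinnertonDyer.Rank1Residual.X11b.AcSelmer.XAc (W.baseChange K) 3 κ 𝔭' ∅ γ) → ∀ (𝔮 : PrimeSpectrum (Literature.NumberTheory.EllipticCurves.UnrSeries 3)), 𝔮.asIdeal.height = 1 → PowerSeries.C ((3 : ℕ) : Literature.NumberTheory.EllipticCurves.unrIntegers 3) ∉ 𝔮.asIdeal → ∀ n : ℕ, (Summit.BirchSwinnertonDyer.Rank1Residual.X11b.AcSelmer.XAc.charIdeal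 (W.baseChange K) 3 κ 𝔭' ∅ γ).map (PowerSeries.map (Summit.BirchSwinnertonDyer.Rank1Residual.X11b.Halves.toUnr 3)) ≤ 𝔮.asIdeal ^ n → Ideal.span {L} ≤ 𝔮.asIdeal ^ n

/-- **C [UNDECIDED · leaf INSTRUMENTABLE/KILLABLE]** cyclicity of the (∅,0) dual Selmer module: for every curve of the
class and every frame, if `X_(∅,0)(E/K_∞)` is Λ-torsion it is generated by ONE element (the zero module included).
By Nakayama and the proved exact control 24475 this is `dim_𝔽₃ Sel_(∅,0)(K, E[3]) ≤ 1` — a finite 3-descent. -/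
def CyclicAcSelmerAtThree : Prop :=
  ∀ (W : WeierstrassCurve ℚ) [W.IsElliptic] [W.IsGloballyMinimal] (N : ℕ) [NeZero N] (K : Type) [Field K] [NumberField K], Summit.BirchSwinnertonDyer.Rank1Residual.Additive.ClassO6 W 3 → W.HasSurjectiveModNGaloisRep 3 → W.analyticRank = 1 → W.conductorNorm ℤ = N → Literature.NumberTheory.EllipticCurves.IsImaginaryQuadratic K → Literature.NumberTheory.EllipticCurves.SatisfiesHeegnerHypothesis N K → ∀ (κ : Literature.NumberTheory.EllipticCurves.ZpExtension K 3), κ.IsAnticyclotomic → ∀ (γ : Field.absoluteGaloisGroup K) [Fact (κ.IsTopGenerator γ)] (𝔭 : IsDedekindDomain.HeightOneSpectrum (NumberField.RingOfIntegers K)), ((3 : ℕ) : NumberField.RingOfIntegers K) ∈ 𝔭.asIdeal → 𝔭.asIdeal.ramificationIdx (NumberField.RingOfIntegers ℚ) = 1 → 𝔭.asIdeal.inertiaDeg (NumberField.RingOfIntegers ℚ) = 1 → ∀ (𝔭' : IsDedekindDomain.HeightOneSpectrum (NumberField.RingOfIntegers K)), ((3 : ℕ) : NumberField.RingOfIntegers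 K) ∈ 𝔭'.asIdeal → 𝔭' ≠ 𝔭 → Module.IsTorsion (Literature.NumberTheory.EllipticCurves.IwasawaAlgebra 3) (Summit.BirchSwinnertonDyer.Rank1Residual.X11b.AcSelmer.XAc (W.baseChange K) 3 κ 𝔭' ∅ γ) → ∃ x : Summit.BirchSwinnertonDyer.Rank1Residual.X11b.AcSelmer.XAc (W.baseChange K) 3 κ 𝔭' ∅ γ, Submodule.span (Literature.NumberTheory.EllipticCurves.IwasawaAlgebra 3) {x} = ⊤

/-- **M [WEAKER-conditional · UNDECIDED; leaves M1 IDEA-NEEDED (non-split P-ordinary patching at p = 3), M2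
ATTACKABLE-literature-with-gap (Klingen constant-term ceiling + FJ multiplicity one), M3 ATTACKABLE (Σ / Dirichlet
bookkeeping)]** CYCLIC MODULAR SATURATION: node I for cyclic `X_(∅,0)` — every (∅,0)-class with values in `Λ_𝔮/𝔮ᵃ`
is a cuspidal–Klingen-Eisenstein congruence of depth `a`, and congruence depth at an interior prime is capped by
`ord_𝔮 L`. -/
def CyclicModularSaturationAtThree : Prop :=
  ∀ (W : WeierstrassCurve ℚ) [W.IsElliptic] [W.IsGloballyMinimal] (N : ℕ) [NeZero N] (K : Type) [Field K] [NumberField K] (Dt : Literature.NumberTheory.EllipticCurves.ModularForms.ModularParametrizationData W N), Summit.BirchSwinnertonDyer.Rank1Residual.Additive.ClassO6 W 3 → W.HasSurjectiveModNGaloisRep 3 → W.analyticRank = 1 → W.conductorNorm ℤ = N → Literature.NumberTheory.EllipticCurves.IsImaginaryQuadratic K → Literature.NumberTheory.EllipticCurves.SatisfiesHeegnerHypothesis N K → ∀ (κ : Literature.NumberTheory.EllipticCurves.ZpExtension K 3), κ.IsAnticyclotomic → ∀ (γ : Field.absoluteGaloisGroup K) [Fact (κ.IsTopGenerator γ)]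 (𝔭 : IsDedekindDomain.HeightOneSpectrum (NumberField.RingOfIntegers K)), ((3 : ℕ) : NumberField.RingOfIntegers K) ∈ 𝔭.asIdeal → 𝔭.asIdeal.ramificationIdx (NumberField.RingOfIntegers ℚ) = 1 → 𝔭.asIdeal.inertiaDeg (NumberField.RingOfIntegers ℚ) = 1 → ∀ (𝔭' : IsDedekindDomain.HeightOneSpectrum (NumberField.RingOfIntegers K)), ((3 : ℕ) : NumberField.RingOfIntegers K) ∈ 𝔭'.asIdeal → 𝔭' ≠ 𝔭 → ∀ (ι' : PadicAlgCl 3 ≃+* ℂ), Summit.BirchSwinnertonDyer.BirchSwinnertonDyer.Theorems.SchneiderFree.BranchInducesPrime 3 ι' 𝔭 → ∀ (ΩK : ℂ) (Ωp : ℂ_[3]) (L : Literature.NumberTheory.EllipticCurves.UnrSeries 3), ΩK ≠ 0 → Ωp ≠ 0 → Literature.NumberTheory.EllipticCurves.IsBDPLFunction ι' 𝔭 κ γ Dt.f ΩK Ωp L → Module.IsTorsion (Literature.NumberTheory.EllipticCurves.IwasawaAlgebra 3) (Summit.BirchSwinnertonDyer.Rank1Residual.X11b.AcSelmer.XAc (W.baseChange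 K) 3 κ 𝔭' ∅ γ) → (∃ x : Summit.BirchSwinnertonDyer.Rank1Residual.X11b.AcSelmer.XAc (W.baseChange K) 3 κ 𝔭' ∅ γ, Submodule.span (Literature.NumberTheory.EllipticCurves.IwasawaAlgebra 3) {x} = ⊤) → ∀ (𝔮 : PrimeSpectrum (Literature.NumberTheory.EllipticCurves.UnrSeries 3)), 𝔮.asIdeal.height = 1 → PowerSeries.C ((3 : ℕ) : Literature.NumberTheory.EllipticCurves.unrIntegers 3) ∉ 𝔮.asIdeal → ∀ n : ℕ, (Summit.BirchSwinnertonDyer.Rank1Residual.X11b.AcSelmer.XAc.charIdeal (W.baseChange K) 3 κ 𝔭' ∅ γ).map (PowerSeries.map (Summit.BirchSwinnertonDyer.Rank1Residual.X11b.Halves.toUnr 3)) ≤ 𝔮.asIdeal ^ n → Ideal.span {L} ≤ 𝔮.asIdeal ^ n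

/-- **CHILD of the EQUIV node (kernel): C ∧ M ⟹ I.** -/
theorem interiorRootwise_of_cyclic_of_saturation
    (hC : CyclicAcSelmerAtThree) (hM : CyclicModularSaturationAtThree) : InteriorRootwiseBoundAtThree := by
  intro W _ _ N _ K _ _ Dt hO6 hsurj hr1 hN hK hH κ hκ γ _ 𝔭 h𝔭 he hf 𝔭' h𝔭' hne ι' hι ΩK Ωp L hΩK hΩp hL htor
  exact hM W N K Dt hO6 hsurj hr1 hN hK hH κ hκ γ 𝔭 h𝔭 he hf 𝔭' h𝔭' hne ι' hι ΩK Ωp L hΩK hΩp hL htor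
    (hC W N K hO6 hsurj hr1 hN hK hH κ hκ γ 𝔭 h𝔭 he hf 𝔭' h𝔭' hne htor)

/-- `3` is a prime element of `R₀ = unrIntegers 3` (a DVR with uniformiser `3`). -/
theorem prime_three_unrIntegers : Prime ((3 : ℕ) : unrIntegers 3) := by
  haveI := Summit.BirchSwinnertonDyer.Rank1Residual.X2.HidaLimitAlgebra.isDiscreteValuationRing_unrIntegers (p := 3)
  exact (Summit.BirchSwinnertonDyer.Rank1Residual.X2.HidaLimitAlgebra.irreducible_natCast_p (p := 3)).prime

/-- The extended characteristic ideal is principal: `Ch_Λ(X)·R₀⟦T⟧ = (F)` for some `F`. -/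
theorem exists_map_charIdeal_eq_span {K : Type} [Field K] [NumberField K] (W : WeierstrassCurve K)
    (κ : ZpExtension K 3) (𝔭' : IsDedekindDomain.HeightOneSpectrum (NumberField.RingOfIntegers K))
    (γ : Field.absoluteGaloisGroup K) [Fact (κ.IsTopGenerator γ)] :
    ∃ F : UnrSeries 3, (AcSelmer.XAc.charIdeal W 3 κ 𝔭' ∅ γ).map (PowerSeries.map (Halves.toUnr 3)) =
      Ideal.span {F} := by
  obtain ⟨f, hf⟩ := (charIdeal_isPrincipal_holds 3 (AcSelmer.XAc W 3 κ 𝔭' ∅ γ)).principal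
  refine ⟨PowerSeries.map (Halves.toUnr 3) f, ?_⟩
  have hf' : AcSelmer.XAc.charIdeal W 3 κ 𝔭' ∅ γ = Ideal.span {f} := by
    change Literature.NumberTheory.EllipticCurves.Module.charIdeal (IwasawaAlgebra 3) (AcSelmer.XAc W 3 κ 𝔭' ∅ γ) =
      Ideal.span {f}
    simpa [Ideal.submodule_span_eq] using hf
  rw [hf', Ideal.map_span, Set.image_singleton]

/-- **EQUIV node, direction used by the line (kernel): I ⟹ 24207.**  Principality of `Ch_Λ·R₀⟦T⟧` + the tree's
height-one criterion over the UFD `R₀⟦T⟧` with `π₀ = C 3`; off the torsion locus `Ch = ⊤` and `k = 0`. -/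
theorem rationalSplitIMCInclusionAtThree_of_interiorRootwise (hI : InteriorRootwiseBoundAtThree) :
    Summit.BirchSwinnertonDyer.BirchSwinnertonDyer.Theses.UniversalToricDescent.RationalSplitIMCInclusionAtThree := by
  intro W _ _ N _ K _ _ Dt hO6 hsurj hr1 hN hK hH κ hκ γ _ 𝔭 h𝔭 he hf 𝔭' h𝔭' hne ι' hι ΩK Ωp L hΩK hΩp hL
  by_cases htor : Module.IsTorsion (IwasawaAlgebra 3) (AcSelmer.XAc (W.baseChange K) 3 κ 𝔭' ∅ γ)
  · obtain ⟨F, hF⟩ := exists_map_charIdeal_eq_span (W.baseChange K) κ 𝔭' γ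
    have h := hI W N K Dt hO6 hsurj hr1 hN hK hH κ hκ γ 𝔭 h𝔭 he hf 𝔭' h𝔭' hne ι' hι ΩK Ωp L hΩK hΩp hL htor
    haveI := Summit.BirchSwinnertonDyer.Rank1Residual.X2.HidaLimitAlgebra.isDiscreteValuationRing_unrIntegers (p := 3)
    obtain ⟨k, hk⟩ := PowerSeries.exists_C_pow_mul_mem_span_of_forall_heightOne prime_three_unrIntegers F
      (Ideal.span {L}) (fun 𝔮 h𝔮 h3 n hn => h 𝔮 h𝔮 h3 n (by rw [hF]; exact hn))
    refine ⟨k, ?_⟩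
    have h3 : ((3 : ℕ) : UnrSeries 3) = C ((3 : ℕ) : unrIntegers 3) := (map_natCast C 3).symm
    rw [hF, h3, ← map_pow]
    exact hk L (Ideal.mem_span_singleton_self L)
  · refine ⟨0, ?_⟩
    have htop : AcSelmer.XAc.charIdeal (W.baseChange K) 3 κ 𝔭' ∅ γ = ⊤ :=
      Summit.BirchSwinnertonDyer.BirchSwinnertonDyer.Theorems.charIdeal_eq_top_of_not_isTorsion (p := 3) _ htor
    rw [htop, Ideal.map_top]; exact Submodule.mem_top

/-- **EQUIV node, converse (kernel): 24207 ⟹ I.**  At a height-one prime `𝔮 = (π) ∌ C 3` of the UFD `R₀⟦T⟧`,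
`πⁿ ∣ 3ᵏ·L` forces `πⁿ ∣ L`. -/
theorem interiorRootwise_of_rationalSplitIMCInclusionAtThree
    (h : Summit.BirchSwinnertonDyer.BirchSwinnertonDyer.Theses.UniversalToricDescent.RationalSplitIMCInclusionAtThree) :
    InteriorRootwiseBoundAtThree := by
  intro W _ _ N _ K _ _ Dt hO6 hsurj hr1 hN hK hH κ hκ γ _ 𝔭 h𝔭 he hf 𝔭' h𝔭' hne ι' hι ΩK Ωp L hΩK hΩp hL _htor
    𝔮 h𝔮 h3 n hn
  obtain ⟨k, hk⟩ := h W N K Dt hO6 hsurj hr1 hN hK hH κ hκ γ 𝔭 h𝔭 he hf 𝔭' h𝔭' hne ι' hι ΩK Ωp L hΩK hΩp hL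
  haveI := Summit.BirchSwinnertonDyer.Rank1Residual.X2.HidaLimitAlgebra.isDiscreteValuationRing_unrIntegers (p := 3)
  haveI : 𝔮.asIdeal.IsPrime := 𝔮.isPrime
  have hne0 : 𝔮.asIdeal ≠ ⊥ := by
    intro hbot
    have h1 := h𝔮
    rw [hbot, Ideal.height_bot] at h1
    exact zero_ne_one h1
  obtain ⟨π, hπmem, hπ⟩ := Ideal.IsPrime.exists_mem_prime_of_ne_bot 𝔮.isPrime hne0
  have heq : 𝔮.asIdeal = Ideal.span {π} := Ideal.eq_span_singleton_of_height_eq_one h𝔮 hπmem hπ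
  rw [heq, Ideal.span_singleton_pow] at hn
  rw [heq, Ideal.span_singleton_pow, Ideal.span_singleton_le_span_singleton]
  have hmem : π ^ n ∣ ((3 : ℕ) : UnrSeries 3) ^ k * L := by
    rw [← Ideal.mem_span_singleton]; exact hn hk
  refine hπ.pow_dvd_of_dvd_mul_left n ?_ hmem
  intro hdvd
  apply h3
  rw [heq, Ideal.mem_span_singleton, map_natCast]
  exact hπ.dvd_of_dvd_pow hdvd

/-- **The line's composition (kernel, BY NAME): C ∧ M ⟹ 24207.** -/
theorem rationalSplitIMCInclusionAtThree_of_cyclic_of_saturation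
    (hC : CyclicAcSelmerAtThree) (hM : CyclicModularSaturationAtThree) :
    Summit.BirchSwinnertonDyer.BirchSwinnertonDyer.Theses.UniversalToricDescent.RationalSplitIMCInclusionAtThree :=
  rationalSplitIMCInclusionAtThree_of_interiorRootwise (interiorRootwise_of_cyclic_of_saturation hC hM)

end Summit.BirchSwinnertonDyer.BirchSwinnertonDyer.Cruxes.RationalSplitIMCInclusionAtThree.NonsplitPatchingSaturation

end
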